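import Literature.MathematicalPhysics.QuantumLattice.GrassmannCovarianceResponseTwoLeg
import HarnessLib

/-!
# The FOUR-leg kernel of a product of two odd Grassmann elements (first brick of the four-leg covariance-response door)

Topic `MathematicalPhysics/QuantumLattice`; sequel of `GrassmannCovarianceResponseTwoLeg.lean` (there: `kernel_two_mul_of_mem_evenOdd_one`,
the two-leg kernel of a product of two ODD elements, and the two-leg response door).  The response of the FOUR-leg kernels of
`effAction C V` to a change of covariance (Salmhofer's RGE read at a 4-string: loop term `kernel (Δ_Ċ 𝒲) 4 X = 15·Σ Ċ(A,B)𝒲₆(X,B,A)` by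
`kernel_grassmannLaplacian`, tree term `−½·kernel (δ𝒲/δψ, Ċ δ𝒲/δψ) 4 X`) needs the degree-`4` kernel of a product of two ODD elements
(`∂_A 𝒲`, `∂_B 𝒲` for even `𝒲`).  Four graded Leibniz expansions (`grassmannDeriv_mul`, parity `involute = ∓1`) leave eight terms with
an odd number of derivatives on each factor:

* **`constPart_deriv_four_mul_of_mem_evenOdd_one`** — `[∂₃∂₂∂₁∂₀(xy)]_∅` as the signed sum of the eight products `[∂_S x]_∅·[∂_{Sᶜ} y]_∅`, `|S|` odd;
* **`kernel_four_mul_of_mem_evenOdd_one`** — `kernel (x·y) 4 X = ¼·Σ_i ((−1)^i x₁(X_i)·y₃(X̂_i) + (−1)^{3−i} x₃(X̂_i)·y₁(X_i))` written out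
  (`x₁ = kernel x 1`, `x₃ = kernel x 3`, `X̂_i` = `X` with the `i`-th label removed, increasing order) — the antisymmetrisation convention of
  `kernel_two_mul_of_mem_evenOdd_one` (`½(x₁(X₀)y₁(X₁) − x₁(X₁)y₁(X₀))`) one degree up.
* §2 (norm forms, `𝕜` = `RCLike`): **`norm_kernel_four_grassmannLaplacian_le(_of_pairing)`** — the loop term `kernel (Δ_C W) 4 X` costs
  `15·Σ‖C(A,B)‖·‖W₆(X,B,A)‖` (`15 = 5·6/2`); **`norm_kernel_four_deriv_mul_deriv_le`** — for EVEN `a, b`: `‖kernel ((∂_A a)(∂_B b)) 4 X‖ ≤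
  2·Σ_i (‖a₂(A,X_i)‖‖b₄(B,X̂_i)‖ + ‖a₄(A,X̂_i)‖‖b₂(B,X_i)‖)` (the summand of the tree term `(δa/δψ, C δb/δψ)` at a 4-string).

Generic finite Grassmann algebra over a commutative `ℚ`-algebra; everything is proved; no definition, no named fact; nothing about any model
is asserted (cell gate-hubbard-kl, K3 ENGINE stub (c) «(c)-HSHIFT-4LEG»: the four-leg twin of the frame-shift response door).

## Sources

M. Salmhofer, *Renormalization: An Introduction* (Springer 1999), §4.3 (4.86)–(4.100) [`Salmhofer1999`]; M. Salmhofer, Commun. Math.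
Phys. 194 (1998) 249–295, §3.1 Prop. 1, §4.1 [`Salmhofer1998`]; F. A. Berezin, *The Method of Second Quantization* (1966), Ch. I §3
(graded Leibniz rule) [`Berezin1966`].
-/

noncomputable section

namespace Literature.MathematicalPhysics.QuantumLattice

open GrassmannAlgebra Finset

section FourLegProduct

variable (R : Type*) [CommRing R] [Algebra ℚ R] {Γ : Type*} [Fintype Γ]

omit [Algebra ℚ R] in
/-- **Four derivatives of a product of two ODD elements, constant part**: with `∂ᵢ = ∂_{Xᵢ}`,
`[∂₃∂₂∂₁∂₀(xy)]_∅ = [∂₂∂₁∂₀x][∂₃y] − [∂₃∂₁∂₀x][∂₂y] + [∂₃∂₂∂₀x][∂₁y] − [∂₃∂₂∂₁x][∂₀y] + [∂₀x][∂₃∂₂∂₁y] − [∂₁x][∂₃∂₂∂₀y] + [∂₂x][∂₃∂₁∂₀y] − [∂₃x][∂₂∂₁∂₀y]`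
(all other terms of the sixteen have an odd factor, whose constant part vanishes). [cite: Berezin1966, Ch. I §3] -/
theorem constPart_deriv_four_mul_of_mem_evenOdd_one {x y : GrassmannAlgebra R Γ} (hx : x ∈ evenOdd R 1) (hy : y ∈ evenOdd R 1)
    (X₀ X₁ X₂ X₃ : Γ) :
    constPart R (grassmannDeriv R X₃ (grassmannDeriv R X₂ (grassmannDeriv R X₁ (grassmannDeriv R X₀ (x * y))))) =
      constPart R (grassmannDeriv R X₂ (grassmannDeriv R X₁ (grassmannDeriv R X₀ x))) * constPart R (grassmannDeriv R X₃ y) -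
        constPart R (grassmannDeriv R X₃ (grassmannDeriv R X₁ (grassmannDeriv R X₀ x))) * constPart R (grassmannDeriv R X₂ y) +
        constPart R (grassmannDeriv R X₃ (grassmannDeriv R X₂ (grassmannDeriv R X₀ x))) * constPart R (grassmannDeriv R X₁ y) -
        constPart R (grassmannDeriv R X₃ (grassmannDeriv R X₂ (grassmannDeriv R X₁ x))) * constPart R (grassmannDeriv R X₀ y) +
        constPart R (grassmannDeriv R X₀ x) * constPart R (grassmannDeriv R X₃ (grassmannDeriv R X₂ (grassmannDeriv R X₁ y))) -
        constPart R (grassmannDeriv R X₁ x) * constPart R (grassmannDeriv R X₃ (grassmannDeriv R X₂ (grassmannDeriv R X₀ y))) +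
        constPart R (grassmannDeriv R X₂ x) * constPart R (grassmannDeriv R X₃ (grassmannDeriv R X₁ (grassmannDeriv R X₀ y))) -
        constPart R (grassmannDeriv R X₃ x) * constPart R (grassmannDeriv R X₂ (grassmannDeriv R X₁ (grassmannDeriv R X₀ y))) := by
  -- parities of the derivatives of `x` and `y`
  have p1 : ∀ {a : GrassmannAlgebra R Γ} (u : Γ), a ∈ evenOdd R 1 → grassmannDeriv R u a ∈ evenOdd R 0 := fun u ha => by
    have h := grassmannDeriv_mem_evenOdd R u ha; rwa [show (1 : ZMod 2) + 1 = 0 from by decide] at h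
  have p0 : ∀ {a : GrassmannAlgebra R Γ} (u : Γ), a ∈ evenOdd R 0 → grassmannDeriv R u a ∈ evenOdd R 1 := fun u ha => by
    have h := grassmannDeriv_mem_evenOdd R u ha; rwa [zero_add] at h
  -- graded Leibniz with an odd / even first factor, specialised to the derivatives of `x`
  have lo : ∀ {a : GrassmannAlgebra R Γ} (_ : a ∈ evenOdd R 1) (b : GrassmannAlgebra R Γ) (u : Γ),
      grassmannDeriv R u (a * b) = grassmannDeriv R u a * b - a * grassmannDeriv R u b := fun ha b u => by
    rw [grassmannDeriv_mul, CliffordAlgebra.involute_eq_of_mem_odd ha, neg_mul, ← sub_eq_add_neg]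
  have le : ∀ {a : GrassmannAlgebra R Γ} (_ : a ∈ evenOdd R 0) (b : GrassmannAlgebra R Γ) (u : Γ),
      grassmannDeriv R u (a * b) = grassmannDeriv R u a * b + a * grassmannDeriv R u b := fun ha b u =>
    grassmannDeriv_mul_of_mem_evenOdd_zero R u ha b
  have r1 : ∀ (b : GrassmannAlgebra R Γ) (u : Γ), grassmannDeriv R u (x * b) = grassmannDeriv R u x * b - x * grassmannDeriv R u b :=
    fun b u => lo hx b u
  have r2 : ∀ (v : Γ) (b : GrassmannAlgebra R Γ) (u : Γ), grassmannDeriv R u (grassmannDeriv R v x * b) =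
      grassmannDeriv R u (grassmannDeriv R v x) * b + grassmannDeriv R v x * grassmannDeriv R u b := fun v b u => le (p1 v hx) b u
  have r3 : ∀ (v w : Γ) (b : GrassmannAlgebra R Γ) (u : Γ), grassmannDeriv R u (grassmannDeriv R w (grassmannDeriv R v x) * b) =
      grassmannDeriv R u (grassmannDeriv R w (grassmannDeriv R v x)) * b -
        grassmannDeriv R w (grassmannDeriv R v x) * grassmannDeriv R u b := fun v w b u => lo (p0 w (p1 v hx)) b u
  have r4 : ∀ (v w z : Γ) (b : GrassmannAlgebra R Γ) (u : Γ),
      grassmannDeriv R u (grassmannDeriv R z (grassmannDeriv R w (grassmannDeriv R v x)) * b) =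
        grassmannDeriv R u (grassmannDeriv R z (grassmannDeriv R w (grassmannDeriv R v x))) * b +
          grassmannDeriv R z (grassmannDeriv R w (grassmannDeriv R v x)) * grassmannDeriv R u b :=
    fun v w z b u => le (p1 z (p0 w (p1 v hx))) b u
  -- constant parts that vanish: odd elements
  have cx : constPart R x = 0 := constPart_eq_zero_of_mem_evenOdd_one R hx
  have cy : constPart R y = 0 := constPart_eq_zero_of_mem_evenOdd_one R hy
  have c2x : ∀ u v : Γ, constPart R (grassmannDeriv R v (grassmannDeriv R u x)) = 0 := fun u v =>
    constPart_eq_zero_of_mem_evenOdd_one R (p0 v (p1 u hx))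
  have c2y : ∀ u v : Γ, constPart R (grassmannDeriv R v (grassmannDeriv R u y)) = 0 := fun u v =>
    constPart_eq_zero_of_mem_evenOdd_one R (p0 v (p1 u hy))
  have c4x : ∀ u v w z : Γ, constPart R (grassmannDeriv R z (grassmannDeriv R w (grassmannDeriv R v (grassmannDeriv R u x)))) = 0 :=
    fun u v w z => constPart_eq_zero_of_mem_evenOdd_one R (p0 z (p1 w (p0 v (p1 u hx))))
  have c4y : ∀ u v w z : Γ, constPart R (grassmannDeriv R z (grassmannDeriv R w (grassmannDeriv R v (grassmannDeriv R u y)))) = 0 :=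
    fun u v w z => constPart_eq_zero_of_mem_evenOdd_one R (p0 z (p1 w (p0 v (p1 u hy))))
  simp only [r1, r2, r3, r4, map_sub, map_add]
  simp only [map_mul, cx, cy, c2x, c2y, c4x, c4y, mul_zero, zero_add, sub_zero]
  ring

omit [Fintype Γ] in
/-- `[∂_c ∂_b ∂_a W]_∅ = 6·kernel W 3 (a,b,c)` (`constPart_iterDeriv_eq_mul_kernel` at a triple). [cite: Salmhofer1999, §4.3 (4.95)] -/
theorem constPart_deriv_three_eq_kernel (W : GrassmannAlgebra R Γ) (a b c : Γ) :
    constPart R (grassmannDeriv R c (grassmannDeriv R b (grassmannDeriv R a W))) = (6 : R) * kernel R W 3 ![a, b, c] := by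
  have h := constPart_iterDeriv_eq_mul_kernel (R := R) ![a, b, c] W
  simp only [iterDeriv_succ_apply, iterDeriv_zero_apply, Matrix.cons_val_zero, Matrix.cons_val_succ, Nat.factorial,
    Nat.succ_eq_add_one, Nat.reduceAdd, Nat.reduceMul, Nat.cast_ofNat] at h
  exact h

/-- **THE FOUR-LEG KERNEL OF A PRODUCT OF TWO ODD ELEMENTS**:
`kernel (x·y) 4 X = ¼·[(x₁(X₀)y₃(X₁,X₂,X₃) − x₁(X₁)y₃(X₀,X₂,X₃) + x₁(X₂)y₃(X₀,X₁,X₃) − x₁(X₃)y₃(X₀,X₁,X₂))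
 + (x₃(X₀,X₁,X₂)y₁(X₃) − x₃(X₀,X₁,X₃)y₁(X₂) + x₃(X₀,X₂,X₃)y₁(X₁) − x₃(X₁,X₂,X₃)y₁(X₀))]` (`x₁ = kernel x 1`, `y₃ = kernel y 3`, …).
[cite: Salmhofer1999, §4.3 (4.95)] -/
theorem kernel_four_mul_of_mem_evenOdd_one {x y : GrassmannAlgebra R Γ} (hx : x ∈ evenOdd R 1) (hy : y ∈ evenOdd R 1)
    (X : Fin 4 → Γ) :
    kernel R (x * y) 4 X = ((1 / 4 : ℚ) • (1 : R)) *
      ((kernel R x 1 ![X 0] * kernel R y 3 ![X 1, X 2, X 3] - kernel R x 1 ![X 1] * kernel R y 3 ![X 0, X 2, X 3] +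
          kernel R x 1 ![X 2] * kernel R y 3 ![X 0, X 1, X 3] - kernel R x 1 ![X 3] * kernel R y 3 ![X 0, X 1, X 2]) +
        (kernel R x 3 ![X 0, X 1, X 2] * kernel R y 1 ![X 3] - kernel R x 3 ![X 0, X 1, X 3] * kernel R y 1 ![X 2] +
          kernel R x 3 ![X 0, X 2, X 3] * kernel R y 1 ![X 1] - kernel R x 3 ![X 1, X 2, X 3] * kernel R y 1 ![X 0])) := by
  rw [kernel_def]
  have hI : iterDeriv R X (x * y) =
      grassmannDeriv R (X 3) (grassmannDeriv R (X 2) (grassmannDeriv R (X 1) (grassmannDeriv R (X 0) (x * y)))) := by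
    simp only [iterDeriv_succ_apply, iterDeriv_zero_apply, Fin.succ_zero_eq_one, Fin.succ_one_eq_two]
    rfl
  rw [hI, constPart_deriv_four_mul_of_mem_evenOdd_one R hx hy]
  simp only [constPart_deriv_three_eq_kernel]
  simp only [← kernel_one_eq_constPart_grassmannDeriv]
  have key' : ((Nat.factorial 4 : ℚ)⁻¹ • (1 : R)) * (6 : R) = ((1 / 4 : ℚ) • (1 : R)) := by
    rw [show (6 : R) = ((6 : ℚ) • (1 : R)) by rw [← Algebra.algebraMap_eq_smul_one, map_ofNat], smul_mul_smul_comm, one_mul,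
      show (Nat.factorial 4 : ℚ) = 24 by norm_num [Nat.factorial]]
    norm_num
  generalize kernel R x 1 ![X 0] = a0 at *
  generalize kernel R x 1 ![X 1] = a1 at *
  generalize kernel R x 1 ![X 2] = a2 at *
  generalize kernel R x 1 ![X 3] = a3 at *
  generalize kernel R y 1 ![X 0] = b0 at *
  generalize kernel R y 1 ![X 1] = b1 at *
  generalize kernel R y 1 ![X 2] = b2 at *
  generalize kernel R y 1 ![X 3] = b3 at *
  generalize kernel R x 3 ![X 0, X 1, X 2] = c3 at *
  generalize kernel R x 3 ![X 0, X 1, X 3] = c2 at *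
  generalize kernel R x 3 ![X 0, X 2, X 3] = c1 at *
  generalize kernel R x 3 ![X 1, X 2, X 3] = c0 at *
  generalize kernel R y 3 ![X 0, X 1, X 2] = d3 at *
  generalize kernel R y 3 ![X 0, X 1, X 3] = d2 at *
  generalize kernel R y 3 ![X 0, X 2, X 3] = d1 at *
  generalize kernel R y 3 ![X 1, X 2, X 3] = d0 at *
  generalize ((Nat.factorial 4 : ℚ)⁻¹ • (1 : R)) = α at *
  generalize ((1 / 4 : ℚ) • (1 : R)) = γ at *
  linear_combination ((a0 * d0 - a1 * d1 + a2 * d2 - a3 * d3) + (c3 * b3 - c2 * b2 + c1 * b1 - c0 * b0)) * key'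

end FourLegProduct


/-! ## §2 The loop and tree terms of the FOUR-leg response at one string (norm forms) -/

section FourLegTerms

variable {𝕜 : Type*} [RCLike 𝕜] {Γ : Type*} [Fintype Γ]

/-- `‖((5·6/2 : ℚ) • 1 : 𝕜)‖ = 15` (bookkeeping). [folklore] -/
private theorem norm_pairPositions_four : ‖(((((4 + 1) * (4 + 2) : ℕ) : ℚ) / 2) • (1 : 𝕜))‖ = 15 := by
  rw [show ((((4 + 1) * (4 + 2) : ℕ) : ℚ) / 2) = (15 : ℚ) by norm_num, Rat.smul_one_eq_cast, Rat.cast_ofNat]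
  exact RCLike.norm_ofNat 15

/-- **The loop term of the four-leg response at one string**: `‖kernel (Δ_C W) 4 X‖ ≤ 15·Σ_{A,B} ‖C(A,B)‖·‖kernel W 6 (X,B,A)‖`
(`kernel_grassmannLaplacian` at degree `4`: `(4+1)(4+2)/2 = 15` positions of the contracted pair). [cite: Salmhofer1999, §4.3.2 (4.86)] -/
theorem norm_kernel_four_grassmannLaplacian_le (C : Matrix Γ Γ 𝕜) (W : GrassmannAlgebra 𝕜 Γ) (X : Fin 4 → Γ) :
    ‖kernel 𝕜 (grassmannLaplacian 𝕜 C W) 4 X‖ ≤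
      15 * ∑ A, ∑ B, ‖C A B‖ * ‖kernel 𝕜 W 6 (Fin.snoc (Fin.snoc X B : Fin 5 → Γ) A)‖ := by
  rw [kernel_grassmannLaplacian, norm_mul, norm_pairPositions_four]
  gcongr
  refine (norm_sum_le _ _).trans (sum_le_sum fun A _ => (norm_sum_le _ _).trans (sum_le_sum fun B _ => ?_))
  rw [norm_mul]

/-- **Loop term for a covariance with a pairing map**, four legs: if `C(A,B) ≠ 0` only for `B = τ A` and the six-leg kernels at the strings
`(X, τA, A)` are bounded by `N`, then `‖kernel (Δ_C W) 4 X‖ ≤ 15·(Σ_A ‖C(A,τA)‖)·N`. [cite: Salmhofer1999, §4.3.2 (4.86)] -/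
theorem norm_kernel_four_grassmannLaplacian_le_of_pairing (C : Matrix Γ Γ 𝕜) (τ : Γ → Γ) (hC : ∀ A B, B ≠ τ A → C A B = 0)
    (W : GrassmannAlgebra 𝕜 Γ) (X : Fin 4 → Γ) {N : ℝ}
    (hN : ∀ A, ‖kernel 𝕜 W 6 (Fin.snoc (Fin.snoc X (τ A) : Fin 5 → Γ) A)‖ ≤ N) :
    ‖kernel 𝕜 (grassmannLaplacian 𝕜 C W) 4 X‖ ≤ 15 * (∑ A, ‖C A (τ A)‖) * N := by
  classical
  refine (norm_kernel_four_grassmannLaplacian_le C W X).trans ?_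
  rw [mul_assoc, sum_mul]
  gcongr with A _
  rw [Finset.sum_eq_single (τ A) (fun B _ hB => by rw [hC A B hB, norm_zero, zero_mul]) (fun h => absurd (mem_univ _) h)]
  exact mul_le_mul_of_nonneg_left (hN A) (norm_nonneg _)

/-- **The four-leg kernel of `(∂_A a)·(∂_B b)` for EVEN `a`, `b`, in norm**: by `kernel_four_mul_of_mem_evenOdd_one` and `kernel_grassmannDeriv`
(`kernel (∂_A a) 1 (Q) = 2·a₂(A,Q)`, `kernel (∂_A a) 3 (Y) = 4·a₄(A,Y)`), each of the eight products is `2·a₂·b₄` or `2·a₄·b₂`: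
`‖kernel ((∂_A a)(∂_B b)) 4 X‖ ≤ 2·Σ_i (‖a₂(A,X_i)‖·‖b₄(B,X̂_i)‖ + ‖a₄(A,X̂_i)‖·‖b₂(B,X_i)‖)`. [cite: Salmhofer1999, §4.3 (4.95)] -/
theorem norm_kernel_four_deriv_mul_deriv_le {a b : GrassmannAlgebra 𝕜 Γ} (ha : a ∈ evenOdd 𝕜 0) (hb : b ∈ evenOdd 𝕜 0) (A B : Γ)
    (X : Fin 4 → Γ) :
    ‖kernel 𝕜 (grassmannDeriv 𝕜 A a * grassmannDeriv 𝕜 B b) 4 X‖ ≤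
      2 * ((‖kernel 𝕜 a 2 ![A, X 0]‖ * ‖kernel 𝕜 b 4 ![B, X 1, X 2, X 3]‖ + ‖kernel 𝕜 a 2 ![A, X 1]‖ * ‖kernel 𝕜 b 4 ![B, X 0, X 2, X 3]‖ +
            ‖kernel 𝕜 a 2 ![A, X 2]‖ * ‖kernel 𝕜 b 4 ![B, X 0, X 1, X 3]‖ + ‖kernel 𝕜 a 2 ![A, X 3]‖ * ‖kernel 𝕜 b 4 ![B, X 0, X 1, X 2]‖) +
          (‖kernel 𝕜 a 4 ![A, X 0, X 1, X 2]‖ * ‖kernel 𝕜 b 2 ![B, X 3]‖ + ‖kernel 𝕜 a 4 ![A, X 0, X 1, X 3]‖ * ‖kernel 𝕜 b 2 ![B, X 2]‖ +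
            ‖kernel 𝕜 a 4 ![A, X 0, X 2, X 3]‖ * ‖kernel 𝕜 b 2 ![B, X 1]‖ + ‖kernel 𝕜 a 4 ![A, X 1, X 2, X 3]‖ * ‖kernel 𝕜 b 2 ![B, X 0]‖)) := by
  have hax : grassmannDeriv 𝕜 A a ∈ evenOdd 𝕜 1 := by have h := grassmannDeriv_mem_evenOdd 𝕜 A ha; rwa [zero_add] at h
  have hbx : grassmannDeriv 𝕜 B b ∈ evenOdd 𝕜 1 := by have h := grassmannDeriv_mem_evenOdd 𝕜 B hb; rwa [zero_add] at h
  rw [kernel_four_mul_of_mem_evenOdd_one 𝕜 hax hbx X]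
  -- pin the derivative's label: `kernel (∂_A a) 1 (Q) = 2·kernel a 2 (A,Q)`, `kernel (∂_A a) 3 Y = 4·kernel a 4 (A,Y)`
  have k1 : ∀ (c : GrassmannAlgebra 𝕜 Γ) (D Q : Γ), kernel 𝕜 (grassmannDeriv 𝕜 D c) 1 ![Q] = 2 * kernel 𝕜 c 2 ![D, Q] := fun c D Q => by
    rw [kernel_grassmannDeriv]; norm_num
  have k3 : ∀ (c : GrassmannAlgebra 𝕜 Γ) (D Q₁ Q₂ Q₃ : Γ), kernel 𝕜 (grassmannDeriv 𝕜 D c) 3 ![Q₁, Q₂, Q₃] = 4 * kernel 𝕜 c 4 ![D, Q₁, Q₂, Q₃] :=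
    fun c D Q₁ Q₂ Q₃ => by rw [kernel_grassmannDeriv]; norm_num
  simp only [k1, k3]
  have hq : ‖((1 / 4 : ℚ) • (1 : 𝕜))‖ = 1 / 4 := by
    rw [Rat.smul_one_eq_cast]; push_cast; rw [norm_div, norm_one, RCLike.norm_ofNat]
  generalize kernel 𝕜 a 2 ![A, X 0] = a0 at *
  generalize kernel 𝕜 a 2 ![A, X 1] = a1 at *
  generalize kernel 𝕜 a 2 ![A, X 2] = a2 at *
  generalize kernel 𝕜 a 2 ![A, X 3] = a3 at *
  generalize kernel 𝕜 b 2 ![B, X 0] = b0 at *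
  generalize kernel 𝕜 b 2 ![B, X 1] = b1 at *
  generalize kernel 𝕜 b 2 ![B, X 2] = b2 at *
  generalize kernel 𝕜 b 2 ![B, X 3] = b3 at *
  generalize kernel 𝕜 a 4 ![A, X 0, X 1, X 2] = c3 at *
  generalize kernel 𝕜 a 4 ![A, X 0, X 1, X 3] = c2 at *
  generalize kernel 𝕜 a 4 ![A, X 0, X 2, X 3] = c1 at *
  generalize kernel 𝕜 a 4 ![A, X 1, X 2, X 3] = c0 at *
  generalize kernel 𝕜 b 4 ![B, X 0, X 1, X 2] = d3 at *
  generalize kernel 𝕜 b 4 ![B, X 0, X 1, X 3] = d2 at *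
  generalize kernel 𝕜 b 4 ![B, X 0, X 2, X 3] = d1 at *
  generalize kernel 𝕜 b 4 ![B, X 1, X 2, X 3] = d0 at *
  rw [norm_mul, hq]
  have h8 : ∀ u v : 𝕜, ‖2 * u * (4 * v)‖ = 8 * (‖u‖ * ‖v‖) := fun u v => by
    simp only [norm_mul, RCLike.norm_ofNat]; ring
  have h8' : ∀ u v : 𝕜, ‖4 * u * (2 * v)‖ = 8 * (‖u‖ * ‖v‖) := fun u v => by
    simp only [norm_mul, RCLike.norm_ofNat]; ring
  have T : ‖(2 * a0 * (4 * d0) - 2 * a1 * (4 * d1) + 2 * a2 * (4 * d2) - 2 * a3 * (4 * d3)) +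
        (4 * c3 * (2 * b3) - 4 * c2 * (2 * b2) + 4 * c1 * (2 * b1) - 4 * c0 * (2 * b0))‖ ≤
      8 * ((‖a0‖ * ‖d0‖ + ‖a1‖ * ‖d1‖ + ‖a2‖ * ‖d2‖ + ‖a3‖ * ‖d3‖) + (‖c3‖ * ‖b3‖ + ‖c2‖ * ‖b2‖ + ‖c1‖ * ‖b1‖ + ‖c0‖ * ‖b0‖)) := by
    refine (norm_add_le _ _).trans ?_
    have e1 := norm_sub_le (2 * a0 * (4 * d0) - 2 * a1 * (4 * d1) + 2 * a2 * (4 * d2)) (2 * a3 * (4 * d3))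
    have e2 := norm_add_le (2 * a0 * (4 * d0) - 2 * a1 * (4 * d1)) (2 * a2 * (4 * d2))
    have e3 := norm_sub_le (2 * a0 * (4 * d0)) (2 * a1 * (4 * d1))
    have f1 := norm_sub_le (4 * c3 * (2 * b3) - 4 * c2 * (2 * b2) + 4 * c1 * (2 * b1)) (4 * c0 * (2 * b0))
    have f2 := norm_add_le (4 * c3 * (2 * b3) - 4 * c2 * (2 * b2)) (4 * c1 * (2 * b1))
    have f3 := norm_sub_le (4 * c3 * (2 * b3)) (4 * c2 * (2 * b2))
    simp only [h8, h8'] at e1 e2 e3 f1 f2 f3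
    linarith
  have hpos : (0 : ℝ) ≤ 1 / 4 := by norm_num
  calc 1 / 4 * ‖(2 * a0 * (4 * d0) - 2 * a1 * (4 * d1) + 2 * a2 * (4 * d2) - 2 * a3 * (4 * d3)) +
          (4 * c3 * (2 * b3) - 4 * c2 * (2 * b2) + 4 * c1 * (2 * b1) - 4 * c0 * (2 * b0))‖
      ≤ 1 / 4 * (8 * ((‖a0‖ * ‖d0‖ + ‖a1‖ * ‖d1‖ + ‖a2‖ * ‖d2‖ + ‖a3‖ * ‖d3‖) +
          (‖c3‖ * ‖b3‖ + ‖c2‖ * ‖b2‖ + ‖c1‖ * ‖b1‖ + ‖c0‖ * ‖b0‖))) := mul_le_mul_of_nonneg_left T hpos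
    _ = _ := by ring

end FourLegTerms

end Literature.MathematicalPhysics.QuantumLattice

end
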